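import Summits.AtomisticToContinuum.FouriersLaw.Theorems.BondHeatUncertaintyBoundedResponseBathHeatOwedHeatB
import HarnessLib

/-!
# BondHeatUncertainty / BoundedResponse — «OwedHeat» §5: the ROUTE STATEMENTS of the tail-cumulative axis — (OH_a) `LateOwedHeatSign`,
(OB_{a,g}) `LateOvershootBudget`, (T2_{a,e}) `LateOwedHeatSquareBudget`, (OHK_a) `LateOwedHeatKickSigned`, (HRS_a) `LateHeatReturnSigned`
(decomp-a2c lens-1, g115, NODE 115 «OwedHeat»; part 3 of 4; imports part B; the doors, the ladder and the overview with the census readout are in the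
main file `…BathHeatOwedHeat`)

Each `def … : Prop` below is a ROUTE STATEMENT of this cell — conjectural, docstring-tagged `UNDECIDED · INSTRUMENTABLE` with its «why it might fail»,
eventually in `N` and at late lags `v ≥ aN` only (the fixed-`N` / all-lag forms are numerically FALSE at `N = 1`, g97) — NOT a literature fact and NOT
11071 or (S) reworded (MustFail115 in the cell's CHECKS-g115.md). Nothing is proved in this file; no `sorry`, no new axioms.
-/

noncomputable section

open MeasureTheory ProbabilityTheory Filter Topology Set Function
open scoped NNReal ENNReal
open Literature.MathematicalPhysics.KineticTheory.HeatConduction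
open Literature.MathematicalPhysics.KineticTheory OscillatorChain
open Literature.Probability.Process
open Summit.AtomisticToContinuum.FouriersLaw.Theorems.SubdiffusiveBondHeat
open Summit.AtomisticToContinuum.FouriersLaw.Theorems.SubdiffusiveBondHeat.EscapeGrading
open Summit.AtomisticToContinuum.FouriersLaw.Theorems.BoundedResponse.TransientBand
open Summit.AtomisticToContinuum.FouriersLaw.Theorems.BoundedResponse.ParityFloor
  (kinObs kinAct continuous_kinObs stronglyMeasurable_kinAct abs_kinAct_le harrisBound_exists weight_facts
    oneSub_stepResponse_sub_escapeDeficit_eq_returnTail)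
open Summit.AtomisticToContinuum.FouriersLaw.Theorems.OddSectorIrreversibility (pinnedChain_stronglyMeasurable_act_uncurry)

namespace Summit.AtomisticToContinuum.FouriersLaw.Theorems.BoundedResponse.HeatSpreading

open Summit.AtomisticToContinuum.FouriersLaw.Theses.BondHeatUncertainty (BoundedResponse SubdiffusiveBondHeat)

section Chain

variable {ω₂ lam β γ : ℝ} {T : ℝ}

/-! ## §5 (NODE 115) The route statements of the TAIL-CUMULATIVE axis -/

/-- **(OH_a) `LateOwedHeatSign a`** — `∃ N₀ ∀ N ≥ N₀ ∀ v ≥ aN: 𝒯_N(v) = ∫_{(v,∞)} K_N ≥ 0`: past the light cone the chain ALWAYS STILL OWES the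
contact heat — the contact step response never overshoots its final value at late lags (`θ_N(v) ≤ θ_N(∞)` for `v ≥ aN`); equivalently
(`lateOwedHeatSign_iff_bathTail_monotoneOn`) the bath tail functional `B_N` is NON-DECREASING IN ITS HORIZON on `[aN, ∞)`. The eventual, late
form of g97's fixed-`N` `ReturnTailSign` (whose `N = 1`, all-`t` instance is numerically refuted: `∫_{2.5}^∞ K_1 = −9.4·10⁻⁴` at `(1,2,1,1,1)` —
dodged here twice, by `N ≥ N₀` and by `v ≥ aN`). STRICTLY BETWEEN the pointwise late kernel sign and every integrated floor: implied by (KS_a)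
(`lateOwedHeatSign_of_signed`) and by (OHK_a); implies `LateOvershootBudget a g` with `C = 0` at every grade. NOT implied by any floor (a floor
tolerates `−C·N`). Why it might be TRUE where pointwise signs are delicate: at `v ≍ aN` the diffusive owed heat is `≍ (T²/γ)·N^{-1/2}` while an
echo lobe of `K_N` contributes `≍ N^{-1}` — the tail sign is protected by a POWER of `N`, the pointwise sign (`K_N(aN) ≍ N^{-3/2}` vs echo `N^{-1}`)
is not. Why it might FAIL: an undamped quasi-ballistic echo train up to the Thouless time (near-integrable regime, where (S) fails too); at fixed
`N` the very late sign is that of the slowest (real, diffusive) mode, so the threat is confined to `aN ≤ v ≲ N²/D`. Tags: UNDECIDED · phonon-TRUE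
(`K_N ≥ 0`) · INSTRUMENTABLE (OWED-115: the running tail of the BKER kernel tables) · IDEA-NEEDED (an emergent maximum principle: positivity
preservation of the COARSE-GRAINED heat semigroup past the light cone). [route statement · this cell; NOT a literature fact] [new] -/
def LateOwedHeatSign (a : ℝ) : Prop :=
  ∀ ω₂ lam β γ : ℝ, 0 < ω₂ → 0 < lam → 0 < β → 0 < γ → ∀ T : ℝ, 0 < T →
    ∃ N₀ : ℕ, ∀ N : ℕ, N₀ ≤ N → ∀ v : ℝ, a * N ≤ v → 0 ≤ owedHeat ω₂ lam β γ T N v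

/-- **(OB_{a,g}) `LateOvershootBudget a g`** — `∀ c > 0 ∃ C N₀ ∀ N ≥ N₀: γ²·𝒪_N(aN, cN²) = γ² ∫_{aN}^{cN²} 𝒯_N(v)⁻ dv ≤ C·N^g`: the
INTEGRATED LATE OVERSHOOT of the contact step response (total owed-heat deficit over the late lags up to the Thouless window) is `O(N^g)`. At
`g = 1` THE NEW WEAKEST ONE-SIDED SUPPLIER of the residual of record: `LateNegMass a ⟹ (OB_{a,1}) ⟹ LateTailFloor a 1 1`
(`lateOvershootBudget_of_lateNegMass`, `lateTailFloor_of_lateOvershootBudget`), both strict as real-variable implications (a kernel whose negative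
lobes are repaid by LATER positive lobes has `𝒪 = 0` but negative mass `≫ N`; a kernel with `𝒯 = −N` on `[aN,2aN]` and `+N` on `[2aN,3aN]` has
`B^late ≥ 0` but `𝒪 ≍ N²`). It charges only NET overshoot — negative kernel mass that is not repaid later — where NODE 109's `𝔐_N` charges every
negative lobe. Why it might fail: as (OH_a), quantitatively (overshoot episodes of depth `≍ 1` per unit lag over `≍ N²` lags). Tags: UNDECIDED ·
phonon-TRUE · INCOMPARABLE with 11071 for `g < 1`, implied by nothing two-sided · INSTRUMENTABLE (OWED-115: `γ²N⁻¹∫(N·R_N)⁻`). [route statement ·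
this cell; NOT a literature fact] [new] -/
def LateOvershootBudget (a g : ℝ) : Prop :=
  ∀ ω₂ lam β γ : ℝ, 0 < ω₂ → 0 < lam → 0 < β → 0 < γ → ∀ T : ℝ, 0 < T → ∀ c : ℝ, 0 < c →
    ∃ C : ℝ, ∃ N₀ : ℕ, ∀ N : ℕ, N₀ ≤ N →
      γ ^ 2 * lateOvershoot ω₂ lam β γ T N (a * N) (c * (N : ℝ) ^ 2) ≤ C * (N : ℝ) ^ g

/-- **(T2_{a,e}) `LateOwedHeatSquareBudget a e`** — `∀ c > 0 ∃ C N₀ ∀ N ≥ N₀: γ⁴ ∫_{aN}^{cN²} 𝒯_N(v)² dv ≤ C·N^e`: the late owed heat is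
SMALL IN MEAN SQUARE — in response units `γ²T⁴∫_{aN}^{cN²}(θ_N(∞) − θ_N(v))² dv = O(N^e)`: the contact step response is `L²`-close to its final
value past the light cone. The SIGN-FREE supplier of the budget: `(T2_{a,e}) ⟹ (OB_{a,1+e/2})` by Cauchy–Schwarz on the window
(`lateOvershootBudget_of_squareBudget`), so `e = 0` already gives (OB_{a,1}) and the residual — immune to late echoes of EITHER sign (an
overshooting and an undershooting step response are charged alike), where (OH)/(OHK)/(HRS) die on one resolved negative episode. TWO-SIDED but
not a floor and not 11071: it says nothing about `θ_N(∞) = 1 − E_N` itself, only about the APPROACH to it. STRICTLY STRONGER than (OB_{a,1})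
(a kernel `K_N ≥ 0` with `𝒯_N ≍ 1` on `[aN, cN²]` has `𝒪 = 𝔐 = 0` but `γ⁴∫𝒯² ≍ N²`: so also `LateNegMass`, (OH), `LateTailFloor` ↛ (T2));
INCOMPARABLE with `LateNegMass` and with (OH) (`𝒯_N(v) = −N^{-1}cos(N²v)` has `γ⁴∫𝒯² ≤ c` but negative mass `≍ N⁴` and no sign). Heuristic
size (diffusive step response `θ_N(∞) − θ_N(v) ≍ (vN)^{-1/2}`, which the desk readout OWED-115 supports): `γ⁴∫𝒯² ≍ γ²T⁴·log N / N → 0`, i.e.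
(T2) should hold at every `e > −1` — ROOM `≍ N/log N` at `e = 0`, and `e < 0` puts the overshoot at grade `< 1` (`lateOvershootBudget_of_squareBudget`:
grade `1 + e/2`). Spectral face (pointer, not used here): `∫(𝒯_N)²` is a low-frequency
`H^{-1}`-type norm `∫|K̂_N(0) − K̂_N(ω)|²ω^{-2}dω` of the boundary spectral function. Why it might fail: a late owed heat that does NOT decay
in `L²` past the light cone — a persistent `O(1)` (kernel units `O(N^{-1})`) oscillation of the step response about its limit lasting `≍ N²`
lags (echo train at the Thouless scale with non-decaying envelope). Tags: UNDECIDED · phonon-TRUE only in the trivial sense (needs the decay, not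
the sign: OPEN for phonons too beyond the diffusive heuristic) · INSTRUMENTABLE (OWED-115: `γ²T⁴Σ_v((1−E_N) − S_N(v))²Δv`) · SIGN-FREE.
[route statement · this cell; NOT a literature fact] [new] -/
def LateOwedHeatSquareBudget (a e : ℝ) : Prop :=
  ∀ ω₂ lam β γ : ℝ, 0 < ω₂ → 0 < lam → 0 < β → 0 < γ → ∀ T : ℝ, 0 < T → ∀ c : ℝ, 0 < c →
    ∃ C : ℝ, ∃ N₀ : ℕ, ∀ N : ℕ, N₀ ≤ N →
      γ ^ 4 * ∫ v in (a * N)..(c * (N : ℝ) ^ 2), owedHeat ω₂ lam β γ T N v ^ 2 ≤ C * (N : ℝ) ^ e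

/-- **(OHK_a) `LateOwedHeatKickSigned a`** — `∃ N₀ ∀ N ≥ N₀ ∀ v ≥ aN ∀ k: (k² − T)·𝔗^v_N(k) ≥ 0`: after a HOT kick the chain still owes the
contact heat at every late lag, after a COLD kick the contact still owes the chain — sign coherence of the KICK-RESOLVED OWED HEAT (the forecast of
the Kubo corrector), not of the instantaneous response. STRICTLY BETWEEN NODE 114's (KS_a) (instantaneous: `(k²−T)(Ḡ_{N,u}(k) − T) ≥ 0 ∀ u ≥ aN`,
which implies it by integrating `u > v`) and BOTH (OH_a) (its `ν_T`-average, via the horizon-monotonicity of `B_N`: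
`lateOwedHeatSign_of_kickSigned`) and the lag-averaged sign (HRS_a) (`lateHeatReturnSigned_of_kickSigned`): a per-kick response that undershoots
and is repaid later violates (KS) but not (OHK). Why it might fail: a kick-selective late echo whose owed-heat integral changes sign for SOME `k`
(hot kicks over-returning). Tags: UNDECIDED · phonon-TRUE · INSTRUMENTABLE (KICK-113 tables integrated beyond `v`) · IDEA-NEEDED. [route statement ·
this cell; NOT a literature fact] [new] -/
def LateOwedHeatKickSigned (a : ℝ) : Prop :=
  ∀ ω₂ lam β γ : ℝ, 0 < ω₂ → 0 < lam → 0 < β → 0 < γ → ∀ T : ℝ, 0 < T →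
    ∃ N₀ : ℕ, ∀ N : ℕ, N₀ ≤ N → ∀ v : ℝ, a * N ≤ v → ∀ k : ℝ, 0 ≤ (k ^ 2 - T) * owedHeatKick ω₂ lam β γ T N v k

/-- **(HRS_a) `LateHeatReturnSigned a`** — `∀ c > 0 ∃ N₀ ∀ N ≥ N₀ ∀ k: (k² − T)·𝔊^{aN,cN²}_N(k) ≥ 0`: NODE 111's late heat-return curve is
SIGN-COHERENT about the thermal kick — the LAG-AVERAGED form of (KS_a) the critic asked for (row 1559, (E5)(α)): the `ℓ`-weighted late return after a
hot kick is net positive. Implied by (KS_a) (`sqSub_mul_heatReturnProfile_nonneg`, NODE 114) and by (OHK_a) (late layer cake); implies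
`LateTailFloor a 1 g` AND `LateHeatReturnFloor a g` with constant `0` at EVERY grade (`𝔇_T(𝔊) = 0`), so it sits above the whole (HRᶠ)/(SEP)
family and is INCOMPARABLE with 11071 (which forces no sign). Weaker than (KS_a)/(OHK_a) because a kick curve may dip below thermal at some late
lags provided the `ℓ`-weighted total does not. Why it might fail: as (OHK_a), but only if the violation survives the `ℓ_{aN,cN²}`-average. Tags:
UNDECIDED · phonon-TRUE · INSTRUMENTABLE (KICK-113 `𝔊`-column sign test) · IDEA-NEEDED. [route statement · this cell; NOT a literature fact] [new] -/
def LateHeatReturnSigned (a : ℝ) : Prop :=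
  ∀ ω₂ lam β γ : ℝ, 0 < ω₂ → 0 < lam → 0 < β → 0 < γ → ∀ T : ℝ, 0 < T → ∀ c : ℝ, 0 < c →
    ∃ N₀ : ℕ, ∀ N : ℕ, N₀ ≤ N → ∀ k : ℝ,
      0 ≤ (k ^ 2 - T) * heatReturnProfile ω₂ lam β γ T N (a * N) (c * (N : ℝ) ^ 2) k

end Chain

end Summit.AtomisticToContinuum.FouriersLaw.Theorems.BoundedResponse.HeatSpreading

end
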